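import Literature.Geometry.Riemannian.PerelmanEntropyMonotonicity
import Literature.Geometry.Riemannian.ConjugateHeatConservation
import HarnessLib

/-!
# No local collapsing for one Ricci flow from the conjugate heat flow and the entropy formula
# (Perelman 2002, §4, Thm. 4.1; Topping 2006, Thm. 8.3.1): the per-flow assembly

`PerelmanEntropyMonotonicity.lean` reduces the named fact `perelman_noLocalCollapsing`
(`CanonicalNeighbourhoods.lean`) to (CH) the solvability of the conjugate heat equation
`□* u = 0` backwards from smooth positive final data and (EF) = (a) conservation of `∫ u dV` +
(b) monotonicity of `𝒲` along such solutions; `ConjugateHeatConservation.lean` proves (EF)(a) for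
closed manifolds modelled on `ℝ^m`. This file assembles the consequences **for one flow**, the
form in which the result is consumed (Chen–Zhu 2006, §4, p. 19, for the given maximal solution on
a closed four-manifold, modelled on `ℝ⁴`):

* `exists_isKappaNoncollapsed_of_muMonotone` — in every dimension (general model `E`): a Ricci
  flow of Riemannian metrics on `[0, T)`, `T > 0`, on a closed manifold satisfying the
  monotonicity (T2) `μ(g(0), τ + t₀) ≤ μ(g(t₀), τ)` (`0 < t₀ < T`, `τ > 0`) is `κ`-noncollapsed on
  every scale `r₀ < √T` for some `κ > 0` (the tree's `exists_isKappaNoncollapsed_of_muMonotone_of_three_le`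
  with the dimension restriction removed by `exists_le_muEntropy`, Topping's Lemma 8.1.8 (ii) in
  all dimensions);
* `exists_isKappaNoncollapsed_of_conjugateHeat` — **on a closed manifold modelled on `ℝ^m`:
  (CH) and (EF)(b) for the given flow, on each `[0, t₀]`, `0 < t₀ < T`, imply `κ`-noncollapsing on
  all scales `< √T`** ((EF)(a) being `IsRicciFlow.integral_conjugateHeat_eq_Icc`).

So, for the flows to which Chen–Zhu apply Perelman's theorem, what remains of Perelman's proof
of Thm. 4.1 is exactly: the backward solvability of the linear parabolic equation
`∂ₜu = −Δ_{g(t)}u + Ru` (Topping 2006, Rem. 8.2.5, §6.4) and the pointwise entropy formula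
`□* v = −2τ|Ric + Hess f − g/2τ|² u` integrated to `d𝒲/dt ≥ 0` (Topping Prop. 8.2.6, 8.2.1;
Perelman (3.4), Prop. 9.1). Everything here is proved; no definitions, no named facts; the named
fact is NOT discharged.

## References

* G. Perelman, *The entropy formula for the Ricci flow and its geometric applications*,
  arXiv:math/0211159 (2002), §3.1, (3.4); §4, Thm. 4.1, Def. 4.2. [Perelman2002]
* P. Topping, *Lectures on the Ricci flow*, LMS Lecture Note Series 325, CUP 2006, §8.1,
  Lemma 8.1.8; §8.2, Prop. 8.2.1, Rem. 8.2.2, Rem. 8.2.5, Prop. 8.2.6; §8.3, Thm. 8.3.1,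
  (8.3.10). [Topping2006]
* B.-L. Chen, X.-P. Zhu, *Ricci flow with surgery on four-manifolds with positive isotropic
  curvature*, J. Differential Geom. 74 (2006), §4, p. 19. [ChenZhu2006]
-/

noncomputable section

open Bundle Set Function Filter Manifold MeasureTheory Module
open scoped Manifold ContDiff Topology ENNReal NNReal

namespace Literature.Geometry.Riemannian

open Lorentzian Lorentzian.PseudoRiemannianMetric

universe v w

/-! ### All dimensions: `κ`-noncollapsing of one flow from (T2) for that flow -/

section MuMonotone

variable {E : Type*} [NormedAddCommGroup E] [NormedSpace ℝ E] [FiniteDimensional ℝ E]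
  {H : Type*} [TopologicalSpace H] {I : ModelWithCorners ℝ E H} [I.Boundaryless]
  {M : Type*} [TopologicalSpace M] [T2Space M] [SecondCountableTopology M] [CompactSpace M]
  [ChartedSpace H M] [IsManifold I ∞ M] [MeasurableSpace M] [BorelSpace M]

/-- **No local collapsing of one flow from the monotonicity of `μ`, in every dimension**
(Perelman 2002, §4, Thm. 4.1; Topping 2006, Thm. 8.3.1): for a Ricci flow of Riemannian metrics
on `[0, T)`, `T > 0`, on a closed manifold (any dimension, any model), IF
`μ(g(0), τ + t₀) ≤ μ(g(t₀), τ)` for all `0 < t₀ < T`, `τ > 0` (Topping (8.3.10) — hypothesis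
(T2) for this flow), then there is `κ > 0` such that the flow is `κ`-noncollapsed (parabolic form
`IsKappaNoncollapsed`) on every scale `r₀ < √T`. The proof is that of the tree's
`exists_isKappaNoncollapsed_of_muMonotone_of_three_le` (metric cutoffs `exists_metric_cutoff`,
the entropy dichotomy `entropyDichotomy_of_cutoffs`, the halving iteration
`ofReal_mul_pow_le_vol_ball_of_doubling`) with the lower bound for `μ` now taken from
`exists_le_muEntropy` (Lemma 8.1.8 (ii) in all dimensions).
[cite: Perelman2002, §4, Thm. 4.1] [cite: Topping2006, §8.3, Thm. 8.3.1 and (8.3.10)] -/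
theorem exists_isKappaNoncollapsed_of_muMonotone {T : ℝ} (hT : 0 < T)
    (g : ℝ → PseudoRiemannianMetric I ∞ E (TangentSpace I : M → Type _))
    (cov : ℝ → CovariantDerivative I E (TangentSpace I : M → Type _))
    (hflow : IsRicciFlow g cov (Ico 0 T)) (hRiem : ∀ t ∈ Ico 0 T, (g t).IsRiemannian)
    (h₂ : ∀ t₀ ∈ Ioo 0 T, ∀ τ : ℝ, 0 < τ →
      (g 0).muEntropy (cov 0) (τ + t₀) ≤ (g t₀).muEntropy (cov t₀) τ) :
    ∃ κ : ℝ, 0 < κ ∧ ∀ r₀ : ℝ, 0 < r₀ → r₀ < Real.sqrt T →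
      IsKappaNoncollapsed g cov (Ico 0 T) κ r₀ := by
  haveI : CompleteSpace E := FiniteDimensional.complete ℝ E
  have hRc : ∀ t ∈ Ico 0 T, Continuous fun x ↦ (g t).scalarCurvatureWith (cov t) x := fun t ht ↦
    (contMDiff_scalarCurvatureWith_holds I M (g t) (cov t) (hflow.isLeviCivita t ht)).continuous
  obtain ⟨C₀, hC₀⟩ := exists_metric_cutoff.{_, _, _}
  have h0 : (0 : ℝ) ∈ Ico 0 T := ⟨le_rfl, hT⟩
  obtain ⟨ξ, hξ, hdich⟩ := entropyDichotomy_of_cutoffs hT hRiem hRc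
    (fun t ht p s hs ↦ hC₀ I M (g t) (hRiem t ht) p s hs) h₂
    (fun τ₀ _ ↦ exists_le_muEntropy (hRiem 0 h0) (hflow.isLeviCivita 0 h0) τ₀)
  refine ⟨ξ, hξ, fun r₀ hr₀ hr₀T x₀ t₀ hS hcurv ↦ ?_⟩
  have ht₀ : t₀ ∈ Icc (t₀ - r₀ ^ 2) t₀ := ⟨by nlinarith, le_rfl⟩
  have ht₀' : t₀ ∈ Ico 0 T := hS ht₀
  refine PseudoRiemannianMetric.ofReal_mul_pow_le_vol_ball_of_doubling (hRiem t₀ ht₀') x₀ hr₀ hξ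
    fun s hs hsr hdoub ↦ hdich t₀ ht₀' x₀ s hs (hsr.trans_lt hr₀T) ?_ hdoub
  refine (hcurv t₀ ht₀).mono (PseudoRiemannianMetric.ball_mono _ _ (ENNReal.ofReal_le_ofReal hsr)) ?_
  gcongr

end MuMonotone

/-! ### Closed manifolds modelled on `ℝ^m`: `κ`-noncollapsing from (CH) ∧ (EF)(b) for the flow -/

section Euclidean

variable {m : ℕ} {H : Type v} [TopologicalSpace H]
  {I : ModelWithCorners ℝ (EuclideanSpace ℝ (Fin m)) H} [I.Boundaryless]
  {M : Type w} [TopologicalSpace M] [ChartedSpace H M] [IsManifold I ∞ M]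
  [T2Space M] [SecondCountableTopology M] [CompactSpace M] [MeasurableSpace M] [BorelSpace M]

/-- **No local collapsing of a Ricci flow on a closed manifold modelled on `ℝ^m` from the
conjugate heat flow and the entropy formula for that flow** (Perelman 2002, §3.1, (3.4) and §4,
Thm. 4.1; Topping 2006, Rem. 8.2.5, Prop. 8.2.1, (8.3.10), Thm. 8.3.1). Let `(g, cov)` be a Ricci
flow of Riemannian metrics on `[0, T)`, `T > 0`, on a closed manifold modelled on `ℝ^m`
(boundaryless model). Assume, for every `0 < t₀ < T`:
* `hCH` (**Topping Rem. 8.2.5 / (6.4.8)**): every smooth positive `u₁` is the value at `t₀` of a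
  positive `u`, `C^∞` on `M × [0, t₀]`, solving `∂ₜu = −Δ_{g(t)}u + Ru` on `[0, t₀]`;
* `hEF` (**Perelman (3.4) / Topping Prop. 8.2.1**): along every such `u` and for every `τ > 0`,
  `t ↦ 𝒲(g(t), f(t), τ + t₀ − t)` is non-decreasing on `[0, t₀]`,
  `f(t) = −log u(t) − (m/2) log (4π(τ + t₀ − t))`.
Then there is `κ > 0` such that the flow is `κ`-noncollapsed on every scale `r₀ < √T`. The
conservation of `∫ u dV` ((EF)(a), Topping Rem. 8.2.2) is supplied by
`IsRicciFlow.integral_conjugateHeat_eq_Icc`; (T2) for the flow follows by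
`muEntropy_le_muEntropy_of_conjugateHeat`, and the conclusion by
`exists_isKappaNoncollapsed_of_muMonotone`.
[cite: Perelman2002, §3.1, (3.4); §4, Thm. 4.1] [cite: Topping2006, §8.2, Prop. 8.2.1, Rem. 8.2.2, Rem. 8.2.5; §8.3, Thm. 8.3.1] -/
theorem exists_isKappaNoncollapsed_of_conjugateHeat {T : ℝ} (hT : 0 < T)
    (g : ℝ → PseudoRiemannianMetric I ∞ (EuclideanSpace ℝ (Fin m)) (TangentSpace I : M → Type _))
    (cov : ℝ → CovariantDerivative I (EuclideanSpace ℝ (Fin m)) (TangentSpace I : M → Type _))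
    (hflow : IsRicciFlow g cov (Ico 0 T)) (hRiem : ∀ t ∈ Ico 0 T, (g t).IsRiemannian)
    (hCH : ∀ t₀ ∈ Ioo 0 T, ∀ u₁ : M → ℝ, ContMDiff I 𝓘(ℝ, ℝ) ∞ u₁ → (∀ x, 0 < u₁ x) →
      ∃ u : ℝ → M → ℝ, u t₀ = u₁ ∧ (∀ t ∈ Icc 0 t₀, ∀ x, 0 < u t x) ∧
        ContMDiffOn (I.prod 𝓘(ℝ, ℝ)) 𝓘(ℝ, ℝ) ∞ (fun p : M × ℝ ↦ u p.2 p.1) (univ ×ˢ Icc 0 t₀) ∧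
        ∀ t ∈ Icc 0 t₀, ∀ x, derivWithin (fun s ↦ u s x) (Icc 0 t₀) t =
          -(g t).laplaceBeltrami (u t) x + (g t).scalarCurvatureWith (cov t) x * u t x)
    (hEF : ∀ t₀ ∈ Ioo 0 T, ∀ u : ℝ → M → ℝ, (∀ t ∈ Icc 0 t₀, ∀ x, 0 < u t x) →
      ContMDiffOn (I.prod 𝓘(ℝ, ℝ)) 𝓘(ℝ, ℝ) ∞ (fun p : M × ℝ ↦ u p.2 p.1) (univ ×ˢ Icc 0 t₀) →
      (∀ t ∈ Icc 0 t₀, ∀ x, derivWithin (fun s ↦ u s x) (Icc 0 t₀) t =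
        -(g t).laplaceBeltrami (u t) x + (g t).scalarCurvatureWith (cov t) x * u t x) →
      ∀ τ : ℝ, 0 < τ →
        MonotoneOn (fun t ↦ (g t).wEntropy (cov t)
          (fun x ↦ -Real.log (u t x) - (m : ℝ) / 2 * Real.log (4 * Real.pi * (τ + t₀ - t)))
          (τ + t₀ - t)) (Icc 0 t₀)) :
    ∃ κ : ℝ, 0 < κ ∧ ∀ r₀ : ℝ, 0 < r₀ → r₀ < Real.sqrt T →
      IsKappaNoncollapsed g cov (Ico 0 T) κ r₀ := by
  refine exists_isKappaNoncollapsed_of_muMonotone hT g cov hflow hRiem fun t₀ ht₀ τ hτ ↦ ?_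
  have hsub : Icc 0 t₀ ⊆ Ico 0 T := fun t ht ↦ ⟨ht.1, ht.2.trans_lt ht₀.2⟩
  have hflow' : IsRicciFlow g cov (Icc 0 t₀) := hflow.mono hsub
  have hRiem' : ∀ t ∈ Icc 0 t₀, (g t).IsRiemannian := fun t ht ↦ hRiem t (hsub ht)
  have hm : (finrank ℝ (EuclideanSpace ℝ (Fin m)) : ℝ) = m := by simp
  refine muEntropy_le_muEntropy_of_conjugateHeat g cov ht₀.1 hτ (hCH t₀ ht₀) ?_
  intro u hpos hsmooth hpde
  refine ⟨fun t ht ↦ hflow'.integral_conjugateHeat_eq_Icc ht₀.1 hRiem' hsmooth hpde ht, ?_⟩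
  rw [hm]
  exact hEF t₀ ht₀ u hpos hsmooth hpde τ hτ

end Euclidean

end Literature.Geometry.Riemannian

end
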